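import Literature.AlgebraicGeometry.HodgeTheory.FermatSurfaceHodgeCharacterThriceCoprimeSix
import Literature.AlgebraicGeometry.Shioda1982.StandardQuadrupleLetter
import Literature.AlgebraicGeometry.Shioda1982.ExceptionalQuadruplesCompleteLeOneHundredEighty
import HarnessLib

/-!
# No exceptional quadruple at the levels `m = 3m''`, `(m'', 6) = 1`, `m'' ∤ 35`, `m'' ≠ 13` (Aoki 1983, Thm. C; Aoki–Shioda 1983, (𝔅²ₘ)(ii))

Everything PROVED (no named facts, no definitions). The multiset / letter form of
`HodgeTheory/FermatSurfaceHodgeCharacterThriceCoprimeSix.lean` (`standard_of_isHodge_thrice_coprime` = [Aoki1983, Thm. C]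
at the levels `3m''`, `(m'', 6) = 1`, `m'' ∤ 35`, `m'' ≠ 13`, function level), in the vocabulary of
`Shioda1982/ExceptionalQuadruples.lean` ([MeyerNeutsch1981Fermatquadrupel] standard / exceptional quadruples) and in the letter
of the tree's named fact `HodgeTheory.AokiShioda1983_thmB2m_standard`:
* **`isStandardQuadruple_of_thrice_coprime`**: the multiset of values of an indecomposable primitive Hodge character of
  length `4` and level `3m''` is a unit multiple of `L₃ = (1, K+1, 2K+1, 3K−3)`, `K = m''` (type C);
* **`forall_dvd_of_isPrimitive_odd`**: at an ODD level, Meyer–Neutsch primitivity `gcd(a₁, …, a₄, m) = 1` of the values of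
  a Hodge character gives `GCD(⟨aᵢ⟩) = 1` (a common divisor `g` prime to `m` divides `∑ ⟨aᵢ⟩ = 2m`, and `g = 2` is
  excluded by the unit `2⁻¹`: `∑ ⟨2⁻¹aᵢ⟩` would be `m`);
* **`not_isExceptionalQuadruple_thrice_coprime`**: `Δ(3m'') = 0` — no Ausnahmequadrupel at these levels (the multiset form,
  the shape of the kernel sweeps `not_isExceptionalQuadruple_N`);
* **`exists_isExceptionalQuadruple_thrice_coprimeSix_iff`**: for `(m'', 6) = 1`, exceptional quadruples of level `3m''`
  exist iff `m'' ∈ {5, 7}` (the kernel sweeps settle `m ∈ {3, 39, 105}`, `level_fifteen` / `level_twentyOne` give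
  `(1, 6, 10, 13)`, `(1, 4, 18, 19)`);
* **`thmB2m_standard_thrice_coprime`**: the letter of the tree's named fact `AokiShioda1983_thmB2m_standard`
  (`HodgeTheory/FermatSurfaceHodgeCharacterStructure`) at every level `m = 3m''`, `(m'', 6) = 1`, `m'' ∤ 35`, `m'' ≠ 13`:
  every indecomposable primitive Hodge character is a permutation of `γⱼ = (j, d+j, 2d+j, −3j)`, `d = m''`
  (via `letter_of_isStandardQuadruple`, `StandardQuadrupleLetter.lean`).
The companion `PicardNumberThreePrime.lean` is the case `m'' = p ≥ 11` prime; `StandardQuadrupleTwiceCoprime.lean` is `m = 2m'`.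

HONEST FRAMING (cell `pub-hfermat`): explicit algebraic cycles for specific Hodge classes on Fermat/Delsarte varieties;
residual open instances listed; no claim on general Hodge. (Surface classes are algebraic by Lefschetz (1,1); this file
restates a proved case of a structure theorem for `𝔅²ₘ`.)

## References
* [Aoki1983] N. Aoki, Math. Ann. 266 (1983) 23–54, Thm. C and §9.
* [AokiShioda1983] N. Aoki, T. Shioda, Progr. Math. 35 (1983) 1–12, §2 Thm (𝔅²ₘ) (ii) c).
* [MeyerNeutsch1981Fermatquadrupel] W. Meyer, W. Neutsch, Math. Ann. 256 (1981) 51–62, (15) p. 53, Tabelle 1 p. 54.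
-/

namespace Literature.AlgebraicGeometry.Shioda1982

open Finset Multiset Literature.AlgebraicGeometry.HodgeTheory Literature.AlgebraicGeometry.HodgeTheory.FermatCharacter

section ThriceCoprime

variable {n : ℕ} [NeZero n]

omit [NeZero n] in
/-- The multiset of values of a `4`-tuple, listed along four pairwise distinct indices. [folklore] -/
private theorem univ_val_map_eq_of_distinct₃ {X : Type*} (α : Fin 4 → X) (a b c d : Fin 4) (hab : a ≠ b)
    (hac : a ≠ c) (had : a ≠ d) (hbc : b ≠ c) (hbd : b ≠ d) (hcd : c ≠ d) :
    univ.val.map α = {α a, α b, α c, α d} := by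
  classical
  have hc4 : #({a, b, c, d} : Finset (Fin 4)) = 4 := by
    rw [Finset.card_insert_of_notMem (by simp [hab, hac, had]),
      Finset.card_insert_of_notMem (by simp [hbc, hbd]), Finset.card_pair hcd]
  have huniv : (univ : Finset (Fin 4)) = {a, b, c, d} :=
    (Finset.eq_univ_of_card _ (by rw [hc4]; simp)).symm
  rw [huniv, Finset.insert_val, Multiset.ndinsert_of_notMem (by simp [hab, hac, had]), Finset.insert_val,
    Multiset.ndinsert_of_notMem (by simp [hbc, hbd]), Finset.insert_val,
    Multiset.ndinsert_of_notMem (by simp [hcd]), Finset.singleton_val]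
  simp only [Multiset.insert_eq_cons, Multiset.map_cons, Multiset.map_singleton]

/-- A unit of `ℤ/3m''` (`3 ∤ m''`) maps `K = m''` to `K` or `2K`, according to its residue mod `3`. [folklore] -/
private theorem unit_mul_third₃ (t : (ZMod (3 * n))ˣ) :
    (t : ZMod (3 * n)) * (n : ZMod (3 * n)) = n ∨ (t : ZMod (3 * n)) * (n : ZMod (3 * n)) = 2 * n := by
  haveI : NeZero (3 * n) := ⟨mul_ne_zero (by norm_num) (NeZero.ne n)⟩
  have hcop : Nat.Coprime (t : ZMod (3 * n)).val (3 * n) := ZMod.val_coe_unit_coprime t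
  have hK3 : (3 : ZMod (3 * n)) * (n : ZMod (3 * n)) = 0 := by
    have : ((3 * n : ℕ) : ZMod (3 * n)) = 0 := ZMod.natCast_self _
    exact_mod_cast this
  have hr : (t : ZMod (3 * n)).val % 3 = 1 ∨ (t : ZMod (3 * n)).val % 3 = 2 := by
    have hne : (t : ZMod (3 * n)).val % 3 ≠ 0 := fun h ↦ by
      have h0 : 3 ∣ (t : ZMod (3 * n)).val := Nat.dvd_of_mod_eq_zero h
      have h31 : 3 ∣ Nat.gcd (t : ZMod (3 * n)).val (3 * n) := Nat.dvd_gcd h0 (dvd_mul_right 3 n)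
      rw [Nat.Coprime.gcd_eq_one hcop] at h31
      exact absurd (Nat.le_of_dvd one_pos h31) (by norm_num)
    omega
  have key : (t : ZMod (3 * n)) * (n : ZMod (3 * n)) =
      (((t : ZMod (3 * n)).val % 3 : ℕ) : ZMod (3 * n)) * (n : ZMod (3 * n)) := by
    conv_lhs => rw [← ZMod.natCast_zmod_val (t : ZMod (3 * n)), ← Nat.div_add_mod (t : ZMod (3 * n)).val 3]
    push_cast
    linear_combination (((t : ZMod (3 * n)).val / 3 : ℕ) : ZMod (3 * n)) * hK3
  rcases hr with hr | hr
  · left; rw [key, hr]; push_cast; ring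
  · right; rw [key, hr]; push_cast; ring

/-- **No exceptional quadruple at the levels `3m''`, `(m'', 6) = 1`, `m'' ∤ 35`, `m'' ≠ 13`:** the multiset of values of a
pair-free primitive Hodge character of length `4` and level `3m''` is a standard quadruple — a unit multiple of
`L₃ = (1, K+1, 2K+1, 3K−3)`, `K = m''` (type C, `t = x`; `x·K ∈ {K, 2K}`) (`standard_of_isHodge_thrice_coprime`).
[cite: Aoki1983, Thm. C] [cite: MeyerNeutsch1981Fermatquadrupel, (15) p. 53 (Standardquadrupel)] -/
theorem isStandardQuadruple_of_thrice_coprime (h6 : n.Coprime 6) (hn35 : ¬ n ∣ 35) (h13 : n ≠ 13)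
    {α : Fin 4 → ZMod (3 * n)} (hα : IsHodge α)
    (hind : ∀ i j : Fin 4, i ≠ j → α i + α j ≠ 0) (hprim : ∀ g : ℕ, (∀ i, g ∣ (α i).val) → g = 1) :
    haveI : NeZero (3 * n) := ⟨mul_ne_zero (by norm_num) (NeZero.ne n)⟩
    IsStandardQuadruple (3 * n) (univ.val.map α) := by
  classical
  haveI : NeZero (3 * n) := ⟨mul_ne_zero (by norm_num) (NeZero.ne n)⟩
  have h3 : 3 ∣ 3 * n := dvd_mul_right 3 n
  have hK : 3 * n / 3 = n := Nat.mul_div_cancel_left n (by norm_num)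
  have h3n : (3 : ZMod (3 * n)) * (n : ZMod (3 * n)) = 0 := by
    have : ((3 * n : ℕ) : ZMod (3 * n)) = 0 := ZMod.natCast_self _
    exact_mod_cast this
  rcases standard_of_isHodge_thrice_coprime h6 hn35 h13 hα hprim with
    ⟨i, j, hij, h⟩ | ⟨i₀, j₁, j₂, j₃, h01, h02, h03, h12, h13', h23, hu, e1, e2, e3⟩
  · exact absurd h (hind i j hij)
  · -- type C: `{x, x + n, x + 2n, -3x} = x · L₃`
    refine ⟨hu.unit, Or.inr ⟨h3, ?_⟩⟩
    rcases unit_mul_third₃ hu.unit with hxn | hxn <;> rw [IsUnit.unit_spec] at hxn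
    · rw [univ_val_map_eq_of_distinct₃ α i₀ j₁ j₂ j₃ h01 h02 h03 h12 h13' h23, e1, e2, e3, stdThree, hK]
      simp only [Multiset.insert_eq_cons, Multiset.map_cons, Multiset.map_singleton, IsUnit.unit_spec,
        mul_one]
      rw [show α i₀ * ((n : ZMod (3 * n)) + 1) = α i₀ + n by rw [mul_add, hxn, mul_one, add_comm],
        show α i₀ * (2 * (n : ZMod (3 * n)) + 1) = α i₀ + 2 * n by linear_combination 2 * hxn,
        show α i₀ * (3 * (n : ZMod (3 * n)) - 3) = -3 * α i₀ by linear_combination 3 * hxn + h3n]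
    · -- `x ≡ 2 (mod 3)`: the middle entries are exchanged
      rw [univ_val_map_eq_of_distinct₃ α i₀ j₂ j₁ j₃ h02 h01 h03 h12.symm h23 h13', e1, e2, e3, stdThree,
        hK]
      simp only [Multiset.insert_eq_cons, Multiset.map_cons, Multiset.map_singleton, IsUnit.unit_spec,
        mul_one]
      rw [show α i₀ * ((n : ZMod (3 * n)) + 1) = α i₀ + 2 * n by rw [mul_add, hxn, mul_one, add_comm],
        show α i₀ * (2 * (n : ZMod (3 * n)) + 1) = α i₀ + n by linear_combination 2 * hxn + h3n,
        show α i₀ * (3 * (n : ZMod (3 * n)) - 3) = -3 * α i₀ by linear_combination 3 * hxn + 2 * h3n]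

/-! ### The multiset form: no exceptional quadruple at the levels `3m''`, `(m'', 6) = 1`, `m'' ∤ 35`, `m'' ≠ 13` -/

omit [NeZero n] in
/-- Divisibility of Meyer–Neutsch's `gcd(a₁, …, a_k, m)` (a right fold of `Nat.gcd`). [folklore] -/
private theorem dvd_foldr_gcd₃ {d b : ℕ} {l : Multiset ℕ} (hb : d ∣ b) (hl : ∀ v ∈ l, d ∣ v) :
    d ∣ l.foldr Nat.gcd b := by
  induction l using Multiset.induction_on with
  | empty => simpa using hb
  | cons a l ih =>
    rw [Multiset.foldr_cons]
    exact Nat.dvd_gcd (hl a (Multiset.mem_cons_self a l)) (ih fun v hv ↦ hl v (Multiset.mem_cons_of_mem hv))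

omit [NeZero n] in
/-- A `4`-tuple whose multiset of values has no pair `a, -a` (as two members) is indecomposable. [folklore] -/
private theorem indecomposable_of_not_hasPair₃ {m : ℕ} {α : Fin 4 → ZMod m} (h : ¬ HasPair (univ.val.map α)) :
    ∀ i j : Fin 4, i ≠ j → α i + α j ≠ 0 := by
  classical
  intro i j hij hsum
  apply h
  refine ⟨α i, Multiset.mem_map.mpr ⟨i, Finset.mem_univ_val i, rfl⟩, ?_⟩
  have hneg : -α i = α j := by linear_combination (-1 : ZMod m) * hsum
  rw [hneg]
  by_cases he : α j = α i
  · have h2 : 2 ≤ Multiset.count (α i) (univ.val.map α) := by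
      rw [count_univ_val_map]
      exact Finset.one_lt_card.mpr ⟨i, by simp, j, by simp [he], hij⟩
    rw [he, ← Multiset.count_pos, Multiset.count_erase_self]
    omega
  · exact (Multiset.mem_erase_of_ne he).mpr (Multiset.mem_map.mpr ⟨j, Finset.mem_univ_val j, rfl⟩)

/-- **At an ODD level, Meyer–Neutsch primitivity `gcd(a₁, …, a₄, m) = 1` of the multiset of values of a Hodge character gives
`GCD(⟨aᵢ⟩) = 1`** in the letter of the named fact: a common divisor `g` of the `⟨aᵢ⟩` divides `∑ ⟨aᵢ⟩ = 2m` and is prime to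
`m`, so `g ∣ 2`; and `g = 2` is impossible, since for the unit `u = 2⁻¹` one would get `⟨u aᵢ⟩ = ⟨aᵢ⟩/2` and
`∑ ⟨u aᵢ⟩ = m ≠ 2m`. [cite: MeyerNeutsch1981Fermatquadrupel, (9)–(10) p. 52] -/
theorem forall_dvd_of_isPrimitive_odd {m : ℕ} [NeZero m] (hm : Odd m) {α : Fin 4 → ZMod m} (hα : IsHodge α)
    (hp : IsPrimitive m (univ.val.map α)) : ∀ g : ℕ, (∀ i, g ∣ (α i).val) → g = 1 := by
  intro g hg
  have hm0 : m ≠ 0 := NeZero.ne m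
  -- `∑ ⟨aᵢ⟩ = 2m`
  have hsum : ∑ i, (α i).val = 2 * m := by
    have h1 := hα.2 1
    simp only [Units.val_one, one_mul] at h1
    change 2 * ∑ i, (α i).val = m * 4 at h1
    omega
  have hg4 : g ∣ 2 * m := hsum ▸ Finset.dvd_sum fun i _ ↦ hg i
  -- `gcd(g, m) = 1`
  have hcop : Nat.Coprime g m := by
    have hd : Nat.gcd g m ∣ ((univ.val.map α).map ZMod.val).foldr Nat.gcd m := by
      refine dvd_foldr_gcd₃ (Nat.gcd_dvd_right _ _) fun v hv ↦ ?_
      obtain ⟨a, ha, rfl⟩ := Multiset.mem_map.mp hv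
      obtain ⟨i, -, rfl⟩ := Multiset.mem_map.mp ha
      exact (Nat.gcd_dvd_left _ _).trans (hg i)
    unfold IsPrimitive at hp
    rw [hp] at hd
    exact Nat.dvd_one.mp hd
  have hg2 : g ∣ 2 := hcop.dvd_of_dvd_mul_right hg4
  have hg0 : g ≠ 0 := fun h ↦ by rw [h] at hg2; exact absurd (Nat.eq_zero_of_zero_dvd hg2) two_ne_zero
  have hgle : g ≤ 2 := Nat.le_of_dvd two_pos hg2
  interval_cases g
  · exact absurd rfl hg0
  · rfl
  · -- all `⟨aᵢ⟩` even: halve with the unit `2⁻¹`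
    exfalso
    have h2u : IsUnit (2 : ZMod m) := by
      rw [show (2 : ZMod m) = ((2 : ℕ) : ZMod m) by norm_cast, ZMod.isUnit_iff_coprime]
      exact Nat.coprime_two_left.mpr hm
    set u : (ZMod m)ˣ := h2u.unit⁻¹ with hu
    have h2inv : (2 : ZMod m) * (u : ZMod m) = 1 := by rw [hu]; exact h2u.mul_val_inv
    -- `⟨u aᵢ⟩ = ⟨aᵢ⟩ / 2`
    have hhalf : ∀ i, ((u : ZMod m) * α i).val = (α i).val / 2 := by
      intro i
      obtain ⟨k, hk⟩ := hg i
      have hk' : (α i).val / 2 = k := by rw [hk]; simp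
      have hklt : k < m := by
        have := ZMod.val_lt (α i)
        omega
      have e : (u : ZMod m) * α i = (k : ZMod m) := by
        have : α i = ((2 * k : ℕ) : ZMod m) := by rw [← hk, ZMod.natCast_zmod_val]
        rw [this, Nat.cast_mul, Nat.cast_ofNat, ← mul_assoc, mul_comm (u : ZMod m), h2inv, one_mul]
      rw [e, ZMod.val_natCast, Nat.mod_eq_of_lt hklt, hk']
    have hu2 := hα.2 u
    unfold normSum at hu2
    simp only [hhalf] at hu2
    -- `∑ ⟨aᵢ⟩/2 = m`, so `2m = 4m`
    have hdiv : ∑ i, (α i).val / 2 = m := by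
      have h2 : ∀ i, 2 * ((α i).val / 2) = (α i).val := fun i ↦ Nat.mul_div_cancel' (hg i)
      have : 2 * ∑ i, (α i).val / 2 = 2 * m := by
        rw [Finset.mul_sum, Finset.sum_congr rfl fun i _ ↦ h2 i, hsum]
      omega
    rw [hdiv] at hu2
    omega

/-- **`Δ(3m'') = 0` for `(m'', 6) = 1`, `m'' ∉ {1, 5, 7, 13, 35}`: there is NO exceptional quadruple (Ausnahmequadrupel) at
these levels** — every Hodge `4`-multiset without a pair `a, -a` and with `gcd(a₁, …, a₄, m) = 1` is a unit multiple of `L₃`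
([Aoki1983, Thm. C] at these levels, in the vocabulary of [MeyerNeutsch1981Fermatquadrupel] / [Shioda1982PicardFermat, Prop. 4];
the kernel sweeps `not_isExceptionalQuadruple_N` are the levels `N ≤ 180` and a few others, `PicardNumberThreePrime` is `m'' = p`).
[cite: Aoki1983, Thm. C] [cite: MeyerNeutsch1981Fermatquadrupel, p. 53 (Standard- und Ausnahmequadrupel)] -/
theorem not_isExceptionalQuadruple_thrice_coprime (h6 : n.Coprime 6) (hn35 : ¬ n ∣ 35) (h13 : n ≠ 13)
    (s : Multiset (ZMod (3 * n))) :
    haveI : NeZero (3 * n) := ⟨mul_ne_zero (by norm_num) (NeZero.ne n)⟩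
    ¬ IsExceptionalQuadruple (3 * n) s := by
  haveI : NeZero (3 * n) := ⟨mul_ne_zero (by norm_num) (NeZero.ne n)⟩
  rintro ⟨h4, hs, hnp, hprim, hns⟩
  obtain ⟨r, α, rfl⟩ := exists_eq_univ_val_map s
  have hr : r = 4 := by rw [card_univ_val_map] at h4; exact h4
  subst hr
  have hα : IsHodge α := (isHodge_iff_isHodgeMultiset α).2 hs
  have hodd : Odd (3 * n) := by
    refine (by decide : Odd 3).mul (Nat.odd_iff.mpr ?_)
    rcases Nat.mod_two_eq_zero_or_one n with h0 | h1
    · exfalso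
      have h26 : (2 : ℕ) ∣ Nat.gcd n 6 := Nat.dvd_gcd (Nat.dvd_of_mod_eq_zero h0) (by norm_num)
      rw [h6] at h26
      exact absurd h26 (by norm_num)
    · exact h1
  exact hns (isStandardQuadruple_of_thrice_coprime h6 hn35 h13 hα (indecomposable_of_not_hasPair₃ hnp)
    (forall_dvd_of_isPrimitive_odd hodd hα hprim))

/-- **At the levels `m = 3m''`, `(m'', 6) = 1`, exceptional quadruples exist iff `m'' ∈ {5, 7}`** (`m = 15, 21`: Meyer–Neutsch's
`(1, 6, 10, 13)`, `(1, 4, 18, 19)`, `ExceptionalQuadruples.level_fifteen` / `level_twentyOne`):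
`not_isExceptionalQuadruple_thrice_coprime` off `m'' ∣ 35`, `m'' = 13`, and the kernel sweeps at the levels `3, 39, 105`
(`tabelleOne N = []`, `not_isExceptionalQuadruple_of_le_oneHundredEighty`).
[cite: Aoki1983, Thm. C] [cite: MeyerNeutsch1981Fermatquadrupel, Satz 2 p. 56 and Tabelle 1 p. 54] [cite: Shioda1982PicardFermat, table p. 727] -/
theorem exists_isExceptionalQuadruple_thrice_coprimeSix_iff (h6 : n.Coprime 6) :
    haveI : NeZero (3 * n) := ⟨mul_ne_zero (by norm_num) (NeZero.ne n)⟩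
    (∃ s, IsExceptionalQuadruple (3 * n) s) ↔ n = 5 ∨ n = 7 := by
  haveI : NeZero (3 * n) := ⟨mul_ne_zero (by norm_num) (NeZero.ne n)⟩
  constructor
  · rintro ⟨s, hs⟩
    by_contra h57
    push Not at h57
    by_cases hn35 : n ∣ 35
    · have hdiv : n = 1 ∨ n = 5 ∨ n = 7 ∨ n = 35 := by
        have h := Nat.mem_divisors.mpr ⟨hn35, (by norm_num : (35 : ℕ) ≠ 0)⟩
        rw [show Nat.divisors 35 = {1, 5, 7, 35} from by decide] at h
        simpa using h
      rcases hdiv with rfl | rfl | rfl | rfl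
      · exact not_isExceptionalQuadruple_of_le_oneHundredEighty (3 * 1) (by norm_num) (by norm_num) (by decide) s hs
      · exact h57.1 rfl
      · exact h57.2 rfl
      · exact not_isExceptionalQuadruple_of_le_oneHundredEighty (3 * 35) (by norm_num) (by norm_num) (by decide) s hs
    · by_cases h13 : n = 13
      · subst h13
        exact not_isExceptionalQuadruple_of_le_oneHundredEighty (3 * 13) (by norm_num) (by norm_num) (by decide) s hs
      · exact not_isExceptionalQuadruple_thrice_coprime h6 hn35 h13 s hs
  · rintro (rfl | rfl)
    · obtain ⟨s, hs⟩ := List.exists_mem_of_length_pos (l := reps 15) (by decide)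
      exact ⟨s, level_fifteen.1 s hs⟩
    · obtain ⟨s, hs⟩ := List.exists_mem_of_length_pos (l := reps 21) (by decide)
      exact ⟨s, level_twentyOne.1 s hs⟩

/-- **Aoki–Shioda 1983, Theorem `(𝔅²ₘ)` (ii) at the levels `m = 3m''`, `(m'', 6) = 1`, `m'' ∤ 35`, `m'' ≠ 13`, in the letter
of the tree's named fact `Literature.AlgebraicGeometry.HodgeTheory.AokiShioda1983_thmB2m_standard`:** every indecomposable
primitive Hodge character `α` of length `4` and level `m` is, after a permutation of the coordinates,
c) `(j, d + j, 2d + j, −3j)` with `m = 3d`, `1 ≤ j < d`, `(j, d) = 1` (and `6j ≠ m`); alternatives a), b) (`m = 2d`) do not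
occur. This is the body of that fact at these `m` (for all such `m`, not only `m > 180`): [Aoki1983, Thm. C] there
(`isStandardQuadruple_of_thrice_coprime`) and the generic bridge `letter_of_isStandardQuadruple`.
[cite: AokiShioda1983, §2 Theorem (𝔅²ₘ) (ii) c), p. 3] [cite: Aoki1983, Thm. C] -/
theorem thmB2m_standard_thrice_coprime (m : ℕ) [NeZero m] (hm : m = 3 * n) (h6 : n.Coprime 6)
    (hn35 : ¬ n ∣ 35) (h13 : n ≠ 13) (α : Fin 4 → ZMod m) (hα : IsHodge α)
    (hind : ∀ i j : Fin 4, i ≠ j → α i + α j ≠ 0) (hprim : ∀ g : ℕ, (∀ i, g ∣ (α i).val) → g = 1) :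
    ∃ σ : Equiv.Perm (Fin 4),
      (∃ d i : ℕ, m = 2 * d ∧ 1 ≤ i ∧ i < d ∧ Nat.Coprime i d ∧ 4 * i ≠ m ∧
          ∀ k, α (σ k) = ![(i : ZMod m), (d : ZMod m) + i, -(2 * (i : ZMod m)), (d : ZMod m)] k) ∨
      (∃ d i : ℕ, m = 2 * d ∧ 1 ≤ i ∧ i < d ∧ Nat.Coprime i d ∧ 3 * i ≠ m ∧ 4 * i ≠ m ∧ 6 * i ≠ m ∧
          ∀ k, α (σ k) = ![(i : ZMod m), (d : ZMod m) + i, (d : ZMod m) + 2 * i, -(4 * (i : ZMod m))] k) ∨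
      (∃ d j : ℕ, m = 3 * d ∧ 1 ≤ j ∧ j < d ∧ Nat.Coprime j d ∧ 6 * j ≠ m ∧
          ∀ k, α (σ k) = ![(j : ZMod m), (d : ZMod m) + j, 2 * (d : ZMod m) + j, -(3 * (j : ZMod m))] k) := by
  subst hm
  exact letter_of_isStandardQuadruple hα.1.1 hind
    (isStandardQuadruple_of_thrice_coprime h6 hn35 h13 hα hind hprim)

end ThriceCoprime

end Literature.AlgebraicGeometry.Shioda1982
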